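import Summits.ResolutionOfSingularities.ResolutionOfSingularities.Theorems.HomologicalConductorNoZenoBeta1SharpCapture
import Summits.ResolutionOfSingularities.ResolutionOfSingularities.Theorems.HomologicalConductorNoZenoInterlacing
import HarnessLib

/-!
# Crux `NoZenoR` (stmt-ResolutionOfSingularities-19943), slot 2 `stub_beta1RankOneSharpF`: the TRANSCENDENCE-DEGREE SPLIT of the
# two residuals of record (`Beta1SharpExhaustive`, `Beta1SharpCapture`) into their tr.deg-3 and tr.deg ≥ 4 halves

OURS (cell res-hironaka, crux chain W4.4; lead res-L0-w44-lead-1 g9, DESK WORD 39 OBJECT 2-R; mirror of res-D-pv-039's slot-3 split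
`CompositeSplit` p584261).  AI-written, weaker than expert review; nothing here is a statement of the manuscript under review (Hironaka 2017).
SUPPORT-level, counted 0.  PACKAGING BY NAME on `Beta1Capture.beta1RankOneSharpF_of_capture` (p584133): pure logic (a case split on the
transcendence degree, a cardinal: `3 ≤ t ∧ t ≠ 3 ⇒ 4 ≤ t` via `Cardinal.natCast_add_one_le_iff`) plus ONE tool lemma; def-free — the texts
ExhHigh / Exh3 (resp. CapHigh / Cap3) are the `h₂` (resp. `h₃`) binder text of `Beta1Capture.beta1RankOneSharp_of_capture` with
«`3 ≤ Algebra.trdeg k K`» replaced by «`4 ≤ Algebra.trdeg k K`» / «`Algebra.trdeg k K = 3`», written out verbatim.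

* `beta1SharpExhaustive_of_split : <ExhHigh> → <Exh3> → <Beta1SharpExhaustive>`, `beta1SharpCapture_of_split : <CapHigh> → <Cap3> → <Beta1SharpCapture>`;
* `beta1RankOneSharpF_of_split : <ExhHigh> → <Exh3> → <CapHigh> → <Cap3> → <Sig.FactsW unfolded> → <slot-2 text>`;
* TOOL LEMMA `exh3_interlaced` (= `Interlacing.exists_regular_between_stages_of_LU3` at Exh3's binders, modulo `CossartPiltant2019LU3`): an
  exhausting tr.deg-3 `ca`-tower is interlaced with regular local rings dominated by `O`.

OUTCOME OF RECORD (desk): slot-2 residual = {ExhHigh, CapHigh} [tr.deg ≥ 4, threadless rank one — FRONTIER-ADJACENT like slot 4] ∪ {Exh3 [«an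
exhausting rank-one zero-dimensional `ca`-tower of a threefold, interlaced with regular local rings, terminates»], Cap3}.
-/

noncomputable section

-- single-problem summit: the doubled namespace component `ResolutionOfSingularities` is forced
set_option linter.dupNamespace false

namespace Summit.ResolutionOfSingularities.ResolutionOfSingularities.Theorems.NoZeno.Beta1Trdeg3

open Summit.ResolutionOfSingularities.ResolutionOfSingularities.Theses.HomologicalConductor
open Summit.ResolutionOfSingularities.ResolutionOfSingularities.Theorems.NoZeno.Birth
open Summit.ResolutionOfSingularities.ResolutionOfSingularities.Theorems.NoZeno.SandwichCluster.Parasite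
open Summit.ResolutionOfSingularities.ResolutionOfSingularities.Theorems
open Summit.ResolutionOfSingularities.ResolutionOfSingularities.Theorems.NoZeno
open Literature.AlgebraicGeometry.Resolution
open IsLocalRing Polynomial

variable {k K : Type} [Field k] [Field K] [Algebra k K]

/-- **`Beta1SharpExhaustive` from its two halves** (`h4` = ExhHigh: `4 ≤ tr.deg`; `h3` = Exh3: `tr.deg = 3`). [this work; pure logic] -/
theorem beta1SharpExhaustive_of_split
    (h4 :
      PersistenceRadical → StrictDrop → ∀ p : ℕ, p.Prime → ∀ (k K : Type) [Field k] [CharP k p] [Field K]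
        [Algebra k K] (O : ValuationSubring K) (A : Subalgebra k K), (∀ c : k, algebraMap k K c ∈ O) →
        A.FG → IsFractionRing ↥A K → A.toSubring ≤ O.toSubring →
        (∀ O' : ValuationSubring K,
          (∀ m : ℕ, ∀ s ∈ tower O A m, s ∈ O' ∧ (s⁻¹ ∈ O' → s⁻¹ ∈ O)) → ¬ IsNoetherianRing ↥O') →
        (∀ O' : ValuationSubring K, O < O' → ∃ m : ℕ, ∃ s ∈ tower O A m, s⁻¹ ∈ O' ∧ s⁻¹ ∉ O) →
        (∀ (k' K' : Type) [Field k'] [CharP k' p] [Field K'] [Algebra k' K'] (O' : ValuationSubring K')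
          (A' : Subalgebra k' K'), (∀ c : k', algebraMap k' K' c ∈ O') → A'.FG → IsFractionRing ↥A' K' →
          A'.toSubring ≤ O'.toSubring → Algebra.trdeg k' K' < Algebra.trdeg k K →
          ∃ m : ℕ, IsRegularLocalRing ↥(tower O' A' m)) →
        (∀ m : ℕ, ∀ s ∈ tower O A m, ∃ f : Polynomial k, f ≠ 0 ∧ O.valuation (Polynomial.aeval s f) < 1) →
        4 ≤ Algebra.trdeg k K →
        (∀ O₁ : ValuationSubring K, O < O₁ → O₁ = ⊤) →
        (∀ x : K, x ∈ O → ∃ m : ℕ, x ∈ tower O A m) →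
        ¬ SingularPrimeThread O A →
        ∃ m : ℕ, IsRegularLocalRing ↥(tower O A m))
    (h3 :
      PersistenceRadical → StrictDrop → ∀ p : ℕ, p.Prime → ∀ (k K : Type) [Field k] [CharP k p] [Field K]
        [Algebra k K] (O : ValuationSubring K) (A : Subalgebra k K), (∀ c : k, algebraMap k K c ∈ O) →
        A.FG → IsFractionRing ↥A K → A.toSubring ≤ O.toSubring →
        (∀ O' : ValuationSubring K,
          (∀ m : ℕ, ∀ s ∈ tower O A m, s ∈ O' ∧ (s⁻¹ ∈ O' → s⁻¹ ∈ O)) → ¬ IsNoetherianRing ↥O') →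
        (∀ O' : ValuationSubring K, O < O' → ∃ m : ℕ, ∃ s ∈ tower O A m, s⁻¹ ∈ O' ∧ s⁻¹ ∉ O) →
        (∀ (k' K' : Type) [Field k'] [CharP k' p] [Field K'] [Algebra k' K'] (O' : ValuationSubring K')
          (A' : Subalgebra k' K'), (∀ c : k', algebraMap k' K' c ∈ O') → A'.FG → IsFractionRing ↥A' K' →
          A'.toSubring ≤ O'.toSubring → Algebra.trdeg k' K' < Algebra.trdeg k K →
          ∃ m : ℕ, IsRegularLocalRing ↥(tower O' A' m)) →
        (∀ m : ℕ, ∀ s ∈ tower O A m, ∃ f : Polynomial k, f ≠ 0 ∧ O.valuation (Polynomial.aeval s f) < 1) →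
        Algebra.trdeg k K = 3 →
        (∀ O₁ : ValuationSubring K, O < O₁ → O₁ = ⊤) →
        (∀ x : K, x ∈ O → ∃ m : ℕ, x ∈ tower O A m) →
        ¬ SingularPrimeThread O A →
        ∃ m : ℕ, IsRegularLocalRing ↥(tower O A m)) :
    PersistenceRadical → StrictDrop → ∀ p : ℕ, p.Prime → ∀ (k K : Type) [Field k] [CharP k p] [Field K]
      [Algebra k K] (O : ValuationSubring K) (A : Subalgebra k K), (∀ c : k, algebraMap k K c ∈ O) →
      A.FG → IsFractionRing ↥A K → A.toSubring ≤ O.toSubring →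
      (∀ O' : ValuationSubring K,
        (∀ m : ℕ, ∀ s ∈ tower O A m, s ∈ O' ∧ (s⁻¹ ∈ O' → s⁻¹ ∈ O)) → ¬ IsNoetherianRing ↥O') →
      (∀ O' : ValuationSubring K, O < O' → ∃ m : ℕ, ∃ s ∈ tower O A m, s⁻¹ ∈ O' ∧ s⁻¹ ∉ O) →
      (∀ (k' K' : Type) [Field k'] [CharP k' p] [Field K'] [Algebra k' K'] (O' : ValuationSubring K')
        (A' : Subalgebra k' K'), (∀ c : k', algebraMap k' K' c ∈ O') → A'.FG → IsFractionRing ↥A' K' →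
        A'.toSubring ≤ O'.toSubring → Algebra.trdeg k' K' < Algebra.trdeg k K →
        ∃ m : ℕ, IsRegularLocalRing ↥(tower O' A' m)) →
      (∀ m : ℕ, ∀ s ∈ tower O A m, ∃ f : Polynomial k, f ≠ 0 ∧ O.valuation (Polynomial.aeval s f) < 1) →
      3 ≤ Algebra.trdeg k K →
      (∀ O₁ : ValuationSubring K, O < O₁ → O₁ = ⊤) →
      (∀ x : K, x ∈ O → ∃ m : ℕ, x ∈ tower O A m) →
      ¬ SingularPrimeThread O A →
      ∃ m : ℕ, IsRegularLocalRing ↥(tower O A m) := by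
  intro hP hD p hp k K _ _ _ _ O A hk hA hfr hAO hker hmax IH hzd htr hr1 hexh hthr
  by_cases heq : Algebra.trdeg k K = 3
  · exact h3 hP hD p hp k K O A hk hA hfr hAO hker hmax IH hzd heq hr1 hexh hthr
  · -- `Algebra.trdeg` is a cardinal: `3 ≤ t`, `t ≠ 3` ⇒ `3 + 1 ≤ t` (as in `CompositeSplit`, res-D-pv-039 p584261)
    have hlt : (3 : Cardinal) < Algebra.trdeg k K := lt_of_le_of_ne htr (Ne.symm heq)
    have key : ((3 : ℕ) : Cardinal) + 1 ≤ Algebra.trdeg k K :=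
      Cardinal.natCast_add_one_le_iff.2 (by exact_mod_cast hlt)
    have e : ((3 : ℕ) : Cardinal) + 1 = 4 := by norm_num
    rw [e] at key
    exact h4 hP hD p hp k K O A hk hA hfr hAO hker hmax IH hzd key hr1 hexh hthr

/-- **`Beta1SharpCapture` from its two halves** (`h4` = CapHigh: `4 ≤ tr.deg`; `h3` = Cap3: `tr.deg = 3`). [this work; pure logic] -/
theorem beta1SharpCapture_of_split
    (h4 :
      PersistenceRadical → StrictDrop → ∀ p : ℕ, p.Prime → ∀ (k K : Type) [Field k] [CharP k p] [Field K]
        [Algebra k K] (O : ValuationSubring K) (A : Subalgebra k K), (∀ c : k, algebraMap k K c ∈ O) →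
        A.FG → IsFractionRing ↥A K → A.toSubring ≤ O.toSubring →
        (∀ O' : ValuationSubring K,
          (∀ m : ℕ, ∀ s ∈ tower O A m, s ∈ O' ∧ (s⁻¹ ∈ O' → s⁻¹ ∈ O)) → ¬ IsNoetherianRing ↥O') →
        (∀ O' : ValuationSubring K, O < O' → ∃ m : ℕ, ∃ s ∈ tower O A m, s⁻¹ ∈ O' ∧ s⁻¹ ∉ O) →
        (∀ (k' K' : Type) [Field k'] [CharP k' p] [Field K'] [Algebra k' K'] (O' : ValuationSubring K')
          (A' : Subalgebra k' K'), (∀ c : k', algebraMap k' K' c ∈ O') → A'.FG → IsFractionRing ↥A' K' →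
          A'.toSubring ≤ O'.toSubring → Algebra.trdeg k' K' < Algebra.trdeg k K →
          ∃ m : ℕ, IsRegularLocalRing ↥(tower O' A' m)) →
        (∀ m : ℕ, ∀ s ∈ tower O A m, ∃ f : Polynomial k, f ≠ 0 ∧ O.valuation (Polynomial.aeval s f) < 1) →
        4 ≤ Algebra.trdeg k K →
        (∀ O₁ : ValuationSubring K, O < O₁ → O₁ = ⊤) →
        (∃ t : K, t ∈ O ∧ (∀ m : ℕ, t ∉ tower O A m) ∧
          ∀ f : Polynomial k, f ≠ 0 → ¬ O.valuation (Polynomial.aeval t f) < 1) →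
        ¬ SingularPrimeThread O A →
        ∃ (N : Subalgebra k K) (m₀ : ℕ), IsNoetherianRing ↥N ∧ N.toSubring ≤ O.toSubring ∧
          ∀ m : ℕ, m₀ ≤ m → ∀ x ∈ ca (tower O A m), x ∈ N)
    (h3 :
      PersistenceRadical → StrictDrop → ∀ p : ℕ, p.Prime → ∀ (k K : Type) [Field k] [CharP k p] [Field K]
        [Algebra k K] (O : ValuationSubring K) (A : Subalgebra k K), (∀ c : k, algebraMap k K c ∈ O) →
        A.FG → IsFractionRing ↥A K → A.toSubring ≤ O.toSubring →
        (∀ O' : ValuationSubring K,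
          (∀ m : ℕ, ∀ s ∈ tower O A m, s ∈ O' ∧ (s⁻¹ ∈ O' → s⁻¹ ∈ O)) → ¬ IsNoetherianRing ↥O') →
        (∀ O' : ValuationSubring K, O < O' → ∃ m : ℕ, ∃ s ∈ tower O A m, s⁻¹ ∈ O' ∧ s⁻¹ ∉ O) →
        (∀ (k' K' : Type) [Field k'] [CharP k' p] [Field K'] [Algebra k' K'] (O' : ValuationSubring K')
          (A' : Subalgebra k' K'), (∀ c : k', algebraMap k' K' c ∈ O') → A'.FG → IsFractionRing ↥A' K' →
          A'.toSubring ≤ O'.toSubring → Algebra.trdeg k' K' < Algebra.trdeg k K →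
          ∃ m : ℕ, IsRegularLocalRing ↥(tower O' A' m)) →
        (∀ m : ℕ, ∀ s ∈ tower O A m, ∃ f : Polynomial k, f ≠ 0 ∧ O.valuation (Polynomial.aeval s f) < 1) →
        Algebra.trdeg k K = 3 →
        (∀ O₁ : ValuationSubring K, O < O₁ → O₁ = ⊤) →
        (∃ t : K, t ∈ O ∧ (∀ m : ℕ, t ∉ tower O A m) ∧
          ∀ f : Polynomial k, f ≠ 0 → ¬ O.valuation (Polynomial.aeval t f) < 1) →
        ¬ SingularPrimeThread O A →
        ∃ (N : Subalgebra k K) (m₀ : ℕ), IsNoetherianRing ↥N ∧ N.toSubring ≤ O.toSubring ∧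
          ∀ m : ℕ, m₀ ≤ m → ∀ x ∈ ca (tower O A m), x ∈ N) :
    PersistenceRadical → StrictDrop → ∀ p : ℕ, p.Prime → ∀ (k K : Type) [Field k] [CharP k p] [Field K]
      [Algebra k K] (O : ValuationSubring K) (A : Subalgebra k K), (∀ c : k, algebraMap k K c ∈ O) →
      A.FG → IsFractionRing ↥A K → A.toSubring ≤ O.toSubring →
      (∀ O' : ValuationSubring K,
        (∀ m : ℕ, ∀ s ∈ tower O A m, s ∈ O' ∧ (s⁻¹ ∈ O' → s⁻¹ ∈ O)) → ¬ IsNoetherianRing ↥O') →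
      (∀ O' : ValuationSubring K, O < O' → ∃ m : ℕ, ∃ s ∈ tower O A m, s⁻¹ ∈ O' ∧ s⁻¹ ∉ O) →
      (∀ (k' K' : Type) [Field k'] [CharP k' p] [Field K'] [Algebra k' K'] (O' : ValuationSubring K')
        (A' : Subalgebra k' K'), (∀ c : k', algebraMap k' K' c ∈ O') → A'.FG → IsFractionRing ↥A' K' →
        A'.toSubring ≤ O'.toSubring → Algebra.trdeg k' K' < Algebra.trdeg k K →
        ∃ m : ℕ, IsRegularLocalRing ↥(tower O' A' m)) →
      (∀ m : ℕ, ∀ s ∈ tower O A m, ∃ f : Polynomial k, f ≠ 0 ∧ O.valuation (Polynomial.aeval s f) < 1) →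
      3 ≤ Algebra.trdeg k K →
      (∀ O₁ : ValuationSubring K, O < O₁ → O₁ = ⊤) →
      (∃ t : K, t ∈ O ∧ (∀ m : ℕ, t ∉ tower O A m) ∧
        ∀ f : Polynomial k, f ≠ 0 → ¬ O.valuation (Polynomial.aeval t f) < 1) →
      ¬ SingularPrimeThread O A →
      ∃ (N : Subalgebra k K) (m₀ : ℕ), IsNoetherianRing ↥N ∧ N.toSubring ≤ O.toSubring ∧
        ∀ m : ℕ, m₀ ≤ m → ∀ x ∈ ca (tower O A m), x ∈ N := by
  intro hP hD p hp k K _ _ _ _ O A hk hA hfr hAO hker hmax IH hzd htr hr1 hb hthr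
  by_cases heq : Algebra.trdeg k K = 3
  · exact h3 hP hD p hp k K O A hk hA hfr hAO hker hmax IH hzd heq hr1 hb hthr
  · -- `Algebra.trdeg` is a cardinal: `3 ≤ t`, `t ≠ 3` ⇒ `3 + 1 ≤ t` (as in `CompositeSplit`, res-D-pv-039 p584261)
    have hlt : (3 : Cardinal) < Algebra.trdeg k K := lt_of_le_of_ne htr (Ne.symm heq)
    have key : ((3 : ℕ) : Cardinal) + 1 ≤ Algebra.trdeg k K :=
      Cardinal.natCast_add_one_le_iff.2 (by exact_mod_cast hlt)
    have e : ((3 : ℕ) : Cardinal) + 1 = 4 := by norm_num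
    rw [e] at key
    exact h4 hP hD p hp k K O A hk hA hfr hAO hker hmax IH hzd key hr1 hb hthr

/-- **SLOT 2 FROM THE FOUR HALVES.**  The registered type of `stub_beta1RankOneSharpF` (`Sig.FactsW` unfolded → the slot text) from ExhHigh (`a`),
Exh3 (`b`), CapHigh (`c`), Cap3 (`d`), by name on `Beta1Capture.beta1RankOneSharpF_of_capture`. [this work; pure logic] -/
theorem beta1RankOneSharpF_of_split
    (a :
      PersistenceRadical → StrictDrop → ∀ p : ℕ, p.Prime → ∀ (k K : Type) [Field k] [CharP k p] [Field K]
        [Algebra k K] (O : ValuationSubring K) (A : Subalgebra k K), (∀ c : k, algebraMap k K c ∈ O) →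
        A.FG → IsFractionRing ↥A K → A.toSubring ≤ O.toSubring →
        (∀ O' : ValuationSubring K,
          (∀ m : ℕ, ∀ s ∈ tower O A m, s ∈ O' ∧ (s⁻¹ ∈ O' → s⁻¹ ∈ O)) → ¬ IsNoetherianRing ↥O') →
        (∀ O' : ValuationSubring K, O < O' → ∃ m : ℕ, ∃ s ∈ tower O A m, s⁻¹ ∈ O' ∧ s⁻¹ ∉ O) →
        (∀ (k' K' : Type) [Field k'] [CharP k' p] [Field K'] [Algebra k' K'] (O' : ValuationSubring K')
          (A' : Subalgebra k' K'), (∀ c : k', algebraMap k' K' c ∈ O') → A'.FG → IsFractionRing ↥A' K' →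
          A'.toSubring ≤ O'.toSubring → Algebra.trdeg k' K' < Algebra.trdeg k K →
          ∃ m : ℕ, IsRegularLocalRing ↥(tower O' A' m)) →
        (∀ m : ℕ, ∀ s ∈ tower O A m, ∃ f : Polynomial k, f ≠ 0 ∧ O.valuation (Polynomial.aeval s f) < 1) →
        4 ≤ Algebra.trdeg k K →
        (∀ O₁ : ValuationSubring K, O < O₁ → O₁ = ⊤) →
        (∀ x : K, x ∈ O → ∃ m : ℕ, x ∈ tower O A m) →
        ¬ SingularPrimeThread O A →
        ∃ m : ℕ, IsRegularLocalRing ↥(tower O A m))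
    (b :
      PersistenceRadical → StrictDrop → ∀ p : ℕ, p.Prime → ∀ (k K : Type) [Field k] [CharP k p] [Field K]
        [Algebra k K] (O : ValuationSubring K) (A : Subalgebra k K), (∀ c : k, algebraMap k K c ∈ O) →
        A.FG → IsFractionRing ↥A K → A.toSubring ≤ O.toSubring →
        (∀ O' : ValuationSubring K,
          (∀ m : ℕ, ∀ s ∈ tower O A m, s ∈ O' ∧ (s⁻¹ ∈ O' → s⁻¹ ∈ O)) → ¬ IsNoetherianRing ↥O') →
        (∀ O' : ValuationSubring K, O < O' → ∃ m : ℕ, ∃ s ∈ tower O A m, s⁻¹ ∈ O' ∧ s⁻¹ ∉ O) →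
        (∀ (k' K' : Type) [Field k'] [CharP k' p] [Field K'] [Algebra k' K'] (O' : ValuationSubring K')
          (A' : Subalgebra k' K'), (∀ c : k', algebraMap k' K' c ∈ O') → A'.FG → IsFractionRing ↥A' K' →
          A'.toSubring ≤ O'.toSubring → Algebra.trdeg k' K' < Algebra.trdeg k K →
          ∃ m : ℕ, IsRegularLocalRing ↥(tower O' A' m)) →
        (∀ m : ℕ, ∀ s ∈ tower O A m, ∃ f : Polynomial k, f ≠ 0 ∧ O.valuation (Polynomial.aeval s f) < 1) →
        Algebra.trdeg k K = 3 →
        (∀ O₁ : ValuationSubring K, O < O₁ → O₁ = ⊤) →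
        (∀ x : K, x ∈ O → ∃ m : ℕ, x ∈ tower O A m) →
        ¬ SingularPrimeThread O A →
        ∃ m : ℕ, IsRegularLocalRing ↥(tower O A m))
    (c :
      PersistenceRadical → StrictDrop → ∀ p : ℕ, p.Prime → ∀ (k K : Type) [Field k] [CharP k p] [Field K]
        [Algebra k K] (O : ValuationSubring K) (A : Subalgebra k K), (∀ c : k, algebraMap k K c ∈ O) →
        A.FG → IsFractionRing ↥A K → A.toSubring ≤ O.toSubring →
        (∀ O' : ValuationSubring K,
          (∀ m : ℕ, ∀ s ∈ tower O A m, s ∈ O' ∧ (s⁻¹ ∈ O' → s⁻¹ ∈ O)) → ¬ IsNoetherianRing ↥O') →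
        (∀ O' : ValuationSubring K, O < O' → ∃ m : ℕ, ∃ s ∈ tower O A m, s⁻¹ ∈ O' ∧ s⁻¹ ∉ O) →
        (∀ (k' K' : Type) [Field k'] [CharP k' p] [Field K'] [Algebra k' K'] (O' : ValuationSubring K')
          (A' : Subalgebra k' K'), (∀ c : k', algebraMap k' K' c ∈ O') → A'.FG → IsFractionRing ↥A' K' →
          A'.toSubring ≤ O'.toSubring → Algebra.trdeg k' K' < Algebra.trdeg k K →
          ∃ m : ℕ, IsRegularLocalRing ↥(tower O' A' m)) →
        (∀ m : ℕ, ∀ s ∈ tower O A m, ∃ f : Polynomial k, f ≠ 0 ∧ O.valuation (Polynomial.aeval s f) < 1) →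
        4 ≤ Algebra.trdeg k K →
        (∀ O₁ : ValuationSubring K, O < O₁ → O₁ = ⊤) →
        (∃ t : K, t ∈ O ∧ (∀ m : ℕ, t ∉ tower O A m) ∧
          ∀ f : Polynomial k, f ≠ 0 → ¬ O.valuation (Polynomial.aeval t f) < 1) →
        ¬ SingularPrimeThread O A →
        ∃ (N : Subalgebra k K) (m₀ : ℕ), IsNoetherianRing ↥N ∧ N.toSubring ≤ O.toSubring ∧
          ∀ m : ℕ, m₀ ≤ m → ∀ x ∈ ca (tower O A m), x ∈ N)
    (d :
      PersistenceRadical → StrictDrop → ∀ p : ℕ, p.Prime → ∀ (k K : Type) [Field k] [CharP k p] [Field K]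
        [Algebra k K] (O : ValuationSubring K) (A : Subalgebra k K), (∀ c : k, algebraMap k K c ∈ O) →
        A.FG → IsFractionRing ↥A K → A.toSubring ≤ O.toSubring →
        (∀ O' : ValuationSubring K,
          (∀ m : ℕ, ∀ s ∈ tower O A m, s ∈ O' ∧ (s⁻¹ ∈ O' → s⁻¹ ∈ O)) → ¬ IsNoetherianRing ↥O') →
        (∀ O' : ValuationSubring K, O < O' → ∃ m : ℕ, ∃ s ∈ tower O A m, s⁻¹ ∈ O' ∧ s⁻¹ ∉ O) →
        (∀ (k' K' : Type) [Field k'] [CharP k' p] [Field K'] [Algebra k' K'] (O' : ValuationSubring K')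
          (A' : Subalgebra k' K'), (∀ c : k', algebraMap k' K' c ∈ O') → A'.FG → IsFractionRing ↥A' K' →
          A'.toSubring ≤ O'.toSubring → Algebra.trdeg k' K' < Algebra.trdeg k K →
          ∃ m : ℕ, IsRegularLocalRing ↥(tower O' A' m)) →
        (∀ m : ℕ, ∀ s ∈ tower O A m, ∃ f : Polynomial k, f ≠ 0 ∧ O.valuation (Polynomial.aeval s f) < 1) →
        Algebra.trdeg k K = 3 →
        (∀ O₁ : ValuationSubring K, O < O₁ → O₁ = ⊤) →
        (∃ t : K, t ∈ O ∧ (∀ m : ℕ, t ∉ tower O A m) ∧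
          ∀ f : Polynomial k, f ≠ 0 → ¬ O.valuation (Polynomial.aeval t f) < 1) →
        ¬ SingularPrimeThread O A →
        ∃ (N : Subalgebra k K) (m₀ : ℕ), IsNoetherianRing ↥N ∧ N.toSubring ≤ O.toSubring ∧
          ∀ m : ℕ, m₀ ≤ m → ∀ x ∈ ca (tower O A m), x ∈ N)
    (hF : (CossartJannsenSaito2020General.{0} ∧ Lipman1969_1_2.{0} ∧ Lipman1969_4_1.{0} ∧ Lipman1969_12_1_i.{0} ∧
        Lipman1969_12_1_ii.{0} ∧ Literature.AlgebraicGeometry.Morphisms.GortzWedhorn2023_24_44_H2.{0}) ∧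
      (Lipman1969_16_1_ii.{0} ∧ Lipman1969_16_5.{0} ∧ Lipman1969_27_1_reg_rat.{0} ∧ Lipman1969_27_3_rat.{0})) :
    PersistenceRadical → StrictDrop → ∀ p : ℕ, p.Prime → ∀ (k K : Type) [Field k] [CharP k p] [Field K]
      [Algebra k K] (O : ValuationSubring K) (A : Subalgebra k K), (∀ c : k, algebraMap k K c ∈ O) →
      A.FG → IsFractionRing ↥A K → A.toSubring ≤ O.toSubring →
      (∀ O' : ValuationSubring K,
        (∀ m : ℕ, ∀ s ∈ tower O A m, s ∈ O' ∧ (s⁻¹ ∈ O' → s⁻¹ ∈ O)) → ¬ IsNoetherianRing ↥O') →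
      (∀ O' : ValuationSubring K, O < O' → ∃ m : ℕ, ∃ s ∈ tower O A m, s⁻¹ ∈ O' ∧ s⁻¹ ∉ O) →
      (∀ (k' K' : Type) [Field k'] [CharP k' p] [Field K'] [Algebra k' K'] (O' : ValuationSubring K')
        (A' : Subalgebra k' K'), (∀ c : k', algebraMap k' K' c ∈ O') → A'.FG → IsFractionRing ↥A' K' →
        A'.toSubring ≤ O'.toSubring → Algebra.trdeg k' K' < Algebra.trdeg k K →
        ∃ m : ℕ, IsRegularLocalRing ↥(tower O' A' m)) →
      (∀ m : ℕ, ∀ s ∈ tower O A m, ∃ f : Polynomial k, f ≠ 0 ∧ O.valuation (Polynomial.aeval s f) < 1) →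
      3 ≤ Algebra.trdeg k K →
      (∀ O₁ : ValuationSubring K, O < O₁ → O₁ = ⊤) →
      ((∀ x : K, x ∈ O → ∃ m : ℕ, x ∈ tower O A m) ∨
        (∃ t : K, t ∈ O ∧ (∀ m : ℕ, t ∉ tower O A m) ∧
          ∀ f : Polynomial k, f ≠ 0 → ¬ O.valuation (Polynomial.aeval t f) < 1)) →
      ¬ SingularPrimeThread O A →
      ∃ m : ℕ, IsRegularLocalRing ↥(tower O A m) :=
  Beta1Capture.beta1RankOneSharpF_of_capture (beta1SharpExhaustive_of_split a b) (beta1SharpCapture_of_split c d) hF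

/-- **TOOL LEMMA at Exh3's binders (modulo `CossartPiltant2019LU3`)**: an exhausting `ca`-tower of a threefold function field is INTERLACED
with regular local rings dominated by `O` — for every `m`, `T_m ≤ R ≤ T_M` (all late `M`) with `R` regular, `Frac R = K`, `loc O R = R`
(`Interlacing.exists_regular_between_stages_of_LU3` with `le_of_eq`). [cite: CossartPiltant2019, Thm. 1.1 with §4.1 (LU)] -/
theorem exh3_interlaced (hLU3 : CossartPiltant2019LU3.{0}) (p : ℕ) (hp : p.Prime)
    (k K : Type) [Field k] [CharP k p] [Field K] [Algebra k K] (O : ValuationSubring K) (A : Subalgebra k K)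
    (hk : ∀ c : k, algebraMap k K c ∈ O) (hA : A.FG) (hfr : IsFractionRing ↥A K) (hAO : A.toSubring ≤ O.toSubring)
    (htr3 : Algebra.trdeg k K = 3) (hexh : ∀ x : K, x ∈ O → ∃ m : ℕ, x ∈ tower O A m) (m : ℕ) :
    ∃ R : Subalgebra k K, IsRegularLocalRing ↥R ∧ IsFractionRing ↥R K ∧ R.toSubring ≤ O.toSubring ∧ loc O R = R ∧
      tower O A m ≤ R ∧ ∃ M₀ : ℕ, ∀ M : ℕ, M₀ ≤ M → R ≤ tower O A M :=
  Interlacing.exists_regular_between_stages_of_LU3 hLU3 p hp k K O A hk hA hfr hAO (le_of_eq htr3) hexh m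

end Summit.ResolutionOfSingularities.ResolutionOfSingularities.Theorems.NoZeno.Beta1Trdeg3

end
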